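import Summits.Ventures.CertifiedManyBodySolver.Observables.SourcedGibbsTrialCapKSpaceFermi
import HarnessLib

/-!
# The HF–BCS sourced cap in momentum space (III): the three one-body sums and the k-space cap

HONEST FRAMING: zero compute in this file; every statement is a PROVED finite-volume identity / inequality about
the free (`U = 0`) `d`-wave pinned torus and the Hartree–Fock–BCS trial-state cap; no number is claimed here (the
certified interval evaluation of the resulting finite sum is a separate kit job of the `hubbard-obs` cell); a sourced
variational CAP bounds nothing about order by itself — it feeds the FLOOR edge of the finite-`h` Hellmann–Feynman
bracket only together with a certified source-free lower row; not a statement about order of the source-free model;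
not a superconductivity verdict.

With `ξ_k = ε_L(k) − μ'`, `g_k = 2√2 h ĝ_d(k)`, `E_k = √(ξ_k² + g_k²)`, `t_k = tanh(βE_k/2)` (`L ≥ 3`):

* `sum_dWaveNambu_mul_torusChar` — symbol of the Nambu matrix against shifted plane waves;
* `bdg_block_trace` — `tr(𝓗_k Ŝ(k)) = −E_k t_k`; `sum_dWaveNambu_mul_fermiMatrix_eq` —
  `Σ_{ij} 𝓗_{ij} F_{ji} = −Σ_k E_k t_k`; `fermiMatrix_dWaveNambu_diag` — diagonal Fermi-matrix entries are momentum
  averages;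
* **`groundEnergy_dWaveSourceTorus_le_HFBCS_kSpace`** — the cap of `groundEnergy_dWaveSourceTorus_le_HFBCS` with its
  right-hand side evaluated in momentum space:
  `E₀(A_L(U,μ,h)) ≤ (−Σ_k E_k t_k − μ'L²) + (μ' − μ)·Σ_k (1 − ξ_k t_k/E_k)
                   + U·L²·[(Σ_k (1 − ξ_k t_k/E_k)/(2L²))² + (Σ_k g_k t_k/(2E_k)/L²)²]`
  for every `β` and trial `μ'` — an explicit finite sum of elementary functions of the momenta, which interval
  arithmetic certifies; `sum_dWave_anomalous_eq_zero` — the last square (the on-site anomalous amplitude) vanishes by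
  the `k₁ ↔ k₂` swap, whence the anomalous-free form **`groundEnergy_dWaveSourceTorus_le_HFBCS_kSpace'`**:
  `E₀ ≤ (−Σ_k E_k t_k − μ'L²) + (μ' − μ)·Σ_k (1 − ξ_k t_k/E_k) + U·L²·(Σ_k (1 − ξ_k t_k/E_k)/(2L²))²`.

References: Bach–Lieb–Solovej, J. Stat. Phys. 76 (1994) 3, §2 [BachLiebSolovej1994]; von Delft–Ralph, Phys. Rep.
345 (2001) 61, §4.2 [VondelftRalph2001].
-/

noncomputable section

open Matrix Finset Literature.MathematicalPhysics.QuantumLattice Literature.Probability.LatticeModels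
open scoped ComplexConjugate

namespace Summit.Ventures.CertifiedManyBodySolver.Observables

/-! ### §4 The three one-body sums of the HF–BCS cap in momentum space, and the k-space cap -/

section KSpaceCap

variable {L : ℕ} [NeZero L]

/-- **Symbol of the Nambu matrix itself against shifted plane waves**:
`Σ_y 𝓗((x,σ),(y,σ')) χ_k(y − w) = χ_k(x − w)·𝓗_k(σ,σ')`, `𝓗_k = [[ξ_k, g_k],[g_k, −ξ_k]]` (`L ≥ 3`).
[cite: BachLiebSolovej1994, §2] -/
theorem sum_dWaveNambu_mul_torusChar (hL : 3 ≤ L) (μ' h : ℝ) (k w : TorusSite 2 L)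
    (x : FermionTorus 2 L) (σ σ' : Fin 2) :
    ∑ y : FermionTorus 2 L,
        bdgNambuMatrix
          (fun x y => if (fermionTorusGraph 2 L).Adj x y then -(1 : ℂ) else 0)
          (fun u v : FermionTorus 2 L => -(h : ℂ) * ∑ i : Fin 2,
            if v = FermionTorus.ofTorusSite (u.toTorusSite + Pi.single i 1) then
              ((Real.sqrt 2 * (if i = 0 then 1 else -1) : ℝ) : ℂ) else 0) μ' (orb x σ) (orb y σ') *
          torusChar k (y.toTorusSite - w) =
      torusChar k (x.toTorusSite - w) *
        (if σ = 0 then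
          (if σ' = 0 then ((torusBand L k - μ' : ℝ) : ℂ) else ((2 * Real.sqrt 2 * h * dWaveGap k : ℝ) : ℂ))
        else
          (if σ' = 0 then ((2 * Real.sqrt 2 * h * dWaveGap k : ℝ) : ℂ) else ((-(torusBand L k - μ') : ℝ) : ℂ))) := by
  set H := bdgNambuMatrix
          (fun x y => if (fermionTorusGraph 2 L).Adj x y then -(1 : ℂ) else 0)
          (fun u v : FermionTorus 2 L => -(h : ℂ) * ∑ i : Fin 2,
            if v = FermionTorus.ofTorusSite (u.toTorusSite + Pi.single i 1) then
              ((Real.sqrt 2 * (if i = 0 then 1 else -1) : ℝ) : ℂ) else 0) μ' with hH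
  have hcol : ∀ τ : Fin 2, ∑ y : FermionTorus 2 L, H (orb x σ) (orb y τ) * torusChar k y.toTorusSite =
      (H *ᵥ planeWave k τ) (orb x σ) := by
    intro τ
    simp only [Matrix.mulVec, dotProduct]
    rw [sum_orb_eq_sum_sum]
    simp only [planeWave_orb, mul_ite, mul_zero, Finset.sum_ite_eq', Finset.mem_univ, if_true]
  have hshift : ∑ y : FermionTorus 2 L, H (orb x σ) (orb y σ') * torusChar k (y.toTorusSite - w) =
      (∑ y : FermionTorus 2 L, H (orb x σ) (orb y σ') * torusChar k y.toTorusSite) * conj (torusChar k w) := by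
    rw [Finset.sum_mul]
    exact Finset.sum_congr rfl fun y _ => by rw [torusChar_sub_right]; ring
  have h0 := dWaveNambu_mulVec_planeWave_zero hL μ' h k
  have h1 := dWaveNambu_mulVec_planeWave_one hL μ' h k
  rw [← hH] at h0 h1
  rw [hshift, hcol σ', torusChar_sub_right]
  by_cases hσ' : σ' = 0
  · subst hσ'
    rw [h0]
    simp only [Pi.add_apply, Pi.smul_apply, smul_eq_mul, planeWave_orb, if_true]
    by_cases hσ : σ = 0
    · subst hσ
      simp only [if_true, zero_ne_one, if_false, mul_zero, add_zero]
      ring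
    · obtain rfl : σ = 1 := Fin.eq_one_of_ne_zero σ hσ
      simp only [one_ne_zero, if_false, if_true, mul_zero, zero_add]
      ring
  · obtain rfl : σ' = 1 := Fin.eq_one_of_ne_zero σ' hσ'
    rw [h1]
    simp only [Pi.sub_apply, Pi.smul_apply, smul_eq_mul, planeWave_orb, one_ne_zero, if_false]
    by_cases hσ : σ = 0
    · subst hσ
      simp only [if_true, zero_ne_one, if_false, mul_zero, sub_zero]
      ring
    · obtain rfl : σ = 1 := Fin.eq_one_of_ne_zero σ hσ
      simp only [one_ne_zero, if_false, if_true, mul_zero, zero_sub]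
      push_cast
      ring

/-- The BdG trace identity `tr(𝓗_k Ŝ(k)) = -E_k tanh(βE_k/2)`: with `q = tanh(βE/2)/(2E)` and `E = √(ξ² + g²)`,
`ξ(½ - qξ) + g(-qg) + g(-qg) + (-ξ)(½ + qξ) = -E tanh(βE/2)` (also for `E = 0`). [cite: VondelftRalph2001, §4.2] -/
theorem bdg_block_trace (β ξ g : ℝ) :
    ξ * (1 / 2 - Real.tanh (β * Real.sqrt (ξ ^ 2 + g ^ 2) / 2) / (2 * Real.sqrt (ξ ^ 2 + g ^ 2)) * ξ) +
        g * (-(Real.tanh (β * Real.sqrt (ξ ^ 2 + g ^ 2) / 2) / (2 * Real.sqrt (ξ ^ 2 + g ^ 2))) * g) +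
        (g * (-(Real.tanh (β * Real.sqrt (ξ ^ 2 + g ^ 2) / 2) / (2 * Real.sqrt (ξ ^ 2 + g ^ 2))) * g) +
          -ξ * (1 / 2 + Real.tanh (β * Real.sqrt (ξ ^ 2 + g ^ 2) / 2) / (2 * Real.sqrt (ξ ^ 2 + g ^ 2)) * ξ)) =
      -(Real.sqrt (ξ ^ 2 + g ^ 2) * Real.tanh (β * Real.sqrt (ξ ^ 2 + g ^ 2) / 2)) := by
  set E := Real.sqrt (ξ ^ 2 + g ^ 2) with hE
  have hE2 : E ^ 2 = ξ ^ 2 + g ^ 2 := Real.sq_sqrt (by positivity)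
  rcases eq_or_ne E 0 with hE0 | hE0
  · rw [hE0] at hE2 ⊢
    have hξ : ξ = 0 := by nlinarith [sq_nonneg ξ, sq_nonneg g]
    have hg : g = 0 := by nlinarith [sq_nonneg ξ, sq_nonneg g]
    subst hξ; subst hg; simp
  · field_simp
    linear_combination (2 : ℝ) * Real.tanh (β * E / 2) * hE2

/-- Rearranging a momentum-space entry under a site sum: `Σ_y f(y)·(a·(g(y)·c)) = a·((Σ_y f(y) g(y))·c)`. [folklore] -/
theorem sum_mul_mul_mul_rearrange {ι : Type*} (s : Finset ι) (f g : ι → ℂ) (a c : ℂ) :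
    ∑ y ∈ s, f y * (a * (g y * c)) = a * ((∑ y ∈ s, f y * g y) * c) := by
  rw [Finset.sum_mul, Finset.mul_sum]
  exact Finset.sum_congr rfl fun y _ => by ring

/-- **Energy sum in momentum space**: `Σ_{ij} 𝓗_{ij} F_{ji} = -Σ_k E_k tanh(βE_k/2)` for the free `d`-wave
pinned torus (`tr(𝓗_k F_k)` summed over the Brillouin zone; `L ≥ 3`). [cite: VondelftRalph2001, §4.2] -/
theorem sum_dWaveNambu_mul_fermiMatrix_eq (hL : 3 ≤ L) (μ' h β : ℝ) :
    (∑ i : Orb (FermionTorus 2 L), ∑ j : Orb (FermionTorus 2 L),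
        bdgNambuMatrix
          (fun x y => if (fermionTorusGraph 2 L).Adj x y then -(1 : ℂ) else 0)
          (fun u v : FermionTorus 2 L => -(h : ℂ) * ∑ i : Fin 2,
            if v = FermionTorus.ofTorusSite (u.toTorusSite + Pi.single i 1) then
              ((Real.sqrt 2 * (if i = 0 then 1 else -1) : ℝ) : ℂ) else 0) μ' i j *
          (1 + NormedSpace.exp ((β : ℂ) • bdgNambuMatrix
          (fun x y => if (fermionTorusGraph 2 L).Adj x y then -(1 : ℂ) else 0)
          (fun u v : FermionTorus 2 L => -(h : ℂ) * ∑ i : Fin 2,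
            if v = FermionTorus.ofTorusSite (u.toTorusSite + Pi.single i 1) then
              ((Real.sqrt 2 * (if i = 0 then 1 else -1) : ℝ) : ℂ) else 0) μ'))⁻¹ j i) =
      ((-∑ k : TorusSite 2 L, Real.sqrt ((torusBand L k - μ') ^ 2 + (2 * Real.sqrt 2 * h * dWaveGap k) ^ 2) * Real.tanh (β * Real.sqrt ((torusBand L k - μ') ^ 2 + (2 * Real.sqrt 2 * h * dWaveGap k) ^ 2) / 2) : ℝ) : ℂ) := by
  have hL0 : ((L : ℂ) ^ 2) ≠ 0 := by
    have : (L : ℂ) ≠ 0 := by exact_mod_cast NeZero.ne L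
    positivity
  -- inner sum over `j = (y, σ')` at fixed `i = (x, σ)`
  have hinner : ∀ (x : FermionTorus 2 L) (σ : Fin 2),
      ∑ j : Orb (FermionTorus 2 L),
        bdgNambuMatrix
          (fun x y => if (fermionTorusGraph 2 L).Adj x y then -(1 : ℂ) else 0)
          (fun u v : FermionTorus 2 L => -(h : ℂ) * ∑ i : Fin 2,
            if v = FermionTorus.ofTorusSite (u.toTorusSite + Pi.single i 1) then
              ((Real.sqrt 2 * (if i = 0 then 1 else -1) : ℝ) : ℂ) else 0) μ' (orb x σ) j *
          (1 + NormedSpace.exp ((β : ℂ) • bdgNambuMatrix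
          (fun x y => if (fermionTorusGraph 2 L).Adj x y then -(1 : ℂ) else 0)
          (fun u v : FermionTorus 2 L => -(h : ℂ) * ∑ i : Fin 2,
            if v = FermionTorus.ofTorusSite (u.toTorusSite + Pi.single i 1) then
              ((Real.sqrt 2 * (if i = 0 then 1 else -1) : ℝ) : ℂ) else 0) μ'))⁻¹ j (orb x σ) =
      ∑ k : TorusSite 2 L, ∑ σ' : Fin 2, ((L : ℂ) ^ 2)⁻¹ *
        ((if σ = 0 then
          (if σ' = 0 then ((torusBand L k - μ' : ℝ) : ℂ) else ((2 * Real.sqrt 2 * h * dWaveGap k : ℝ) : ℂ))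
        else
          (if σ' = 0 then ((2 * Real.sqrt 2 * h * dWaveGap k : ℝ) : ℂ) else ((-(torusBand L k - μ') : ℝ) : ℂ))) *
        (if σ' = 0 then
          (if σ = 0 then ((1 / 2 - Real.tanh (β * Real.sqrt ((torusBand L k - μ') ^ 2 + (2 * Real.sqrt 2 * h * dWaveGap k) ^ 2) / 2) / (2 * Real.sqrt ((torusBand L k - μ') ^ 2 + (2 * Real.sqrt 2 * h * dWaveGap k) ^ 2)) * (torusBand L k - μ') : ℝ) : ℂ) else ((-(Real.tanh (β * Real.sqrt ((torusBand L k - μ') ^ 2 + (2 * Real.sqrt 2 * h * dWaveGap k) ^ 2) / 2) / (2 * Real.sqrt ((torusBand L k - μ') ^ 2 + (2 * Real.sqrt 2 * h * dWaveGap k) ^ 2)) * (2 * Real.sqrt 2 * h * dWaveGap k)) : ℝ) : ℂ))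
        else
          (if σ = 0 then ((-(Real.tanh (β * Real.sqrt ((torusBand L k - μ') ^ 2 + (2 * Real.sqrt 2 * h * dWaveGap k) ^ 2) / 2) / (2 * Real.sqrt ((torusBand L k - μ') ^ 2 + (2 * Real.sqrt 2 * h * dWaveGap k) ^ 2)) * (2 * Real.sqrt 2 * h * dWaveGap k)) : ℝ) : ℂ) else ((1 / 2 + Real.tanh (β * Real.sqrt ((torusBand L k - μ') ^ 2 + (2 * Real.sqrt 2 * h * dWaveGap k) ^ 2) / 2) / (2 * Real.sqrt ((torusBand L k - μ') ^ 2 + (2 * Real.sqrt 2 * h * dWaveGap k) ^ 2)) * (torusBand L k - μ') : ℝ) : ℂ)))) := by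
    intro x σ
    rw [sum_orb_eq_sum_sum]
    have hF : ∀ (y : FermionTorus 2 L) (σ' : Fin 2), (1 + NormedSpace.exp ((β : ℂ) • bdgNambuMatrix
          (fun x y => if (fermionTorusGraph 2 L).Adj x y then -(1 : ℂ) else 0)
          (fun u v : FermionTorus 2 L => -(h : ℂ) * ∑ i : Fin 2,
            if v = FermionTorus.ofTorusSite (u.toTorusSite + Pi.single i 1) then
              ((Real.sqrt 2 * (if i = 0 then 1 else -1) : ℝ) : ℂ) else 0) μ'))⁻¹ (orb y σ') (orb x σ) = _ :=
      fun y σ' => fermiMatrix_dWaveNambu_apply hL μ' h β y x σ' σ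
    have step1 : ∀ (y : FermionTorus 2 L) (σ' : Fin 2),
        bdgNambuMatrix
          (fun x y => if (fermionTorusGraph 2 L).Adj x y then -(1 : ℂ) else 0)
          (fun u v : FermionTorus 2 L => -(h : ℂ) * ∑ i : Fin 2,
            if v = FermionTorus.ofTorusSite (u.toTorusSite + Pi.single i 1) then
              ((Real.sqrt 2 * (if i = 0 then 1 else -1) : ℝ) : ℂ) else 0) μ' (orb x σ) (orb y σ') * (1 + NormedSpace.exp ((β : ℂ) • bdgNambuMatrix
          (fun x y => if (fermionTorusGraph 2 L).Adj x y then -(1 : ℂ) else 0)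
          (fun u v : FermionTorus 2 L => -(h : ℂ) * ∑ i : Fin 2,
            if v = FermionTorus.ofTorusSite (u.toTorusSite + Pi.single i 1) then
              ((Real.sqrt 2 * (if i = 0 then 1 else -1) : ℝ) : ℂ) else 0) μ'))⁻¹ (orb y σ') (orb x σ) =
        ∑ k : TorusSite 2 L, ((L : ℂ) ^ 2)⁻¹ * ((if σ' = 0 then
          (if σ = 0 then ((1 / 2 - Real.tanh (β * Real.sqrt ((torusBand L k - μ') ^ 2 + (2 * Real.sqrt 2 * h * dWaveGap k) ^ 2) / 2) / (2 * Real.sqrt ((torusBand L k - μ') ^ 2 + (2 * Real.sqrt 2 * h * dWaveGap k) ^ 2)) * (torusBand L k - μ') : ℝ) : ℂ) else ((-(Real.tanh (β * Real.sqrt ((torusBand L k - μ') ^ 2 + (2 * Real.sqrt 2 * h * dWaveGap k) ^ 2) / 2) / (2 * Real.sqrt ((torusBand L k - μ') ^ 2 + (2 * Real.sqrt 2 * h * dWaveGap k) ^ 2)) * (2 * Real.sqrt 2 * h * dWaveGap k)) : ℝ) : ℂ))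
        else
          (if σ = 0 then ((-(Real.tanh (β * Real.sqrt ((torusBand L k - μ') ^ 2 + (2 * Real.sqrt 2 * h * dWaveGap k) ^ 2) / 2) / (2 * Real.sqrt ((torusBand L k - μ') ^ 2 + (2 * Real.sqrt 2 * h * dWaveGap k) ^ 2)) * (2 * Real.sqrt 2 * h * dWaveGap k)) : ℝ) : ℂ) else ((1 / 2 + Real.tanh (β * Real.sqrt ((torusBand L k - μ') ^ 2 + (2 * Real.sqrt 2 * h * dWaveGap k) ^ 2) / 2) / (2 * Real.sqrt ((torusBand L k - μ') ^ 2 + (2 * Real.sqrt 2 * h * dWaveGap k) ^ 2)) * (torusBand L k - μ') : ℝ) : ℂ))) *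
          (bdgNambuMatrix
          (fun x y => if (fermionTorusGraph 2 L).Adj x y then -(1 : ℂ) else 0)
          (fun u v : FermionTorus 2 L => -(h : ℂ) * ∑ i : Fin 2,
            if v = FermionTorus.ofTorusSite (u.toTorusSite + Pi.single i 1) then
              ((Real.sqrt 2 * (if i = 0 then 1 else -1) : ℝ) : ℂ) else 0) μ' (orb x σ) (orb y σ') * torusChar k (y.toTorusSite - x.toTorusSite))) := by
      intro y σ'
      rw [hF y σ', Finset.mul_sum, Finset.mul_sum]
      exact Finset.sum_congr rfl fun k _ => by ring
    rw [Finset.sum_congr rfl fun y _ => Finset.sum_congr rfl fun σ' _ => step1 y σ']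
    rw [Finset.sum_comm]
    rw [Finset.sum_congr rfl fun σ' _ => Finset.sum_comm]
    rw [Finset.sum_comm]
    refine Finset.sum_congr rfl fun k _ => Finset.sum_congr rfl fun σ' _ => ?_
    have hsym := sum_dWaveNambu_mul_torusChar hL μ' h k x.toTorusSite x σ σ'
    rw [sub_self, torusChar_zero_right, one_mul] at hsym
    rw [← Finset.mul_sum, ← Finset.mul_sum, hsym]
    ring
  rw [sum_orb_eq_sum_sum, Finset.sum_congr rfl fun x _ => Finset.sum_congr rfl fun σ _ => hinner x σ]
  -- the `2 × 2` trace per momentum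
  have htr : ∀ k : TorusSite 2 L, ∑ σ : Fin 2, ∑ σ' : Fin 2, ((L : ℂ) ^ 2)⁻¹ *
      ((if σ = 0 then
          (if σ' = 0 then ((torusBand L k - μ' : ℝ) : ℂ) else ((2 * Real.sqrt 2 * h * dWaveGap k : ℝ) : ℂ))
        else
          (if σ' = 0 then ((2 * Real.sqrt 2 * h * dWaveGap k : ℝ) : ℂ) else ((-(torusBand L k - μ') : ℝ) : ℂ))) *
        (if σ' = 0 then
          (if σ = 0 then ((1 / 2 - Real.tanh (β * Real.sqrt ((torusBand L k - μ') ^ 2 + (2 * Real.sqrt 2 * h * dWaveGap k) ^ 2) / 2) / (2 * Real.sqrt ((torusBand L k - μ') ^ 2 + (2 * Real.sqrt 2 * h * dWaveGap k) ^ 2)) * (torusBand L k - μ') : ℝ) : ℂ) else ((-(Real.tanh (β * Real.sqrt ((torusBand L k - μ') ^ 2 + (2 * Real.sqrt 2 * h * dWaveGap k) ^ 2) / 2) / (2 * Real.sqrt ((torusBand L k - μ') ^ 2 + (2 * Real.sqrt 2 * h * dWaveGap k) ^ 2)) * (2 * Real.sqrt 2 * h * dWaveGap k)) : ℝ) : 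ℂ))
        else
          (if σ = 0 then ((-(Real.tanh (β * Real.sqrt ((torusBand L k - μ') ^ 2 + (2 * Real.sqrt 2 * h * dWaveGap k) ^ 2) / 2) / (2 * Real.sqrt ((torusBand L k - μ') ^ 2 + (2 * Real.sqrt 2 * h * dWaveGap k) ^ 2)) * (2 * Real.sqrt 2 * h * dWaveGap k)) : ℝ) : ℂ) else ((1 / 2 + Real.tanh (β * Real.sqrt ((torusBand L k - μ') ^ 2 + (2 * Real.sqrt 2 * h * dWaveGap k) ^ 2) / 2) / (2 * Real.sqrt ((torusBand L k - μ') ^ 2 + (2 * Real.sqrt 2 * h * dWaveGap k) ^ 2)) * (torusBand L k - μ') : ℝ) : ℂ)))) =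
      ((L : ℂ) ^ 2)⁻¹ * (((-(Real.sqrt ((torusBand L k - μ') ^ 2 + (2 * Real.sqrt 2 * h * dWaveGap k) ^ 2) * Real.tanh (β * Real.sqrt ((torusBand L k - μ') ^ 2 + (2 * Real.sqrt 2 * h * dWaveGap k) ^ 2) / 2))) : ℝ) : ℂ) := by
    intro k
    simp only [Fin.sum_univ_two, if_true, one_ne_zero, if_false]
    have := bdg_block_trace β (torusBand L k - μ') (2 * Real.sqrt 2 * h * dWaveGap k)
    rw [← this]
    push_cast
    ring
  -- sum over `x`: `L²` identical terms
  have hx : ∀ x : FermionTorus 2 L, ∑ σ : Fin 2, ∑ k : TorusSite 2 L, ∑ σ' : Fin 2, ((L : ℂ) ^ 2)⁻¹ *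
      ((if σ = 0 then
          (if σ' = 0 then ((torusBand L k - μ' : ℝ) : ℂ) else ((2 * Real.sqrt 2 * h * dWaveGap k : ℝ) : ℂ))
        else
          (if σ' = 0 then ((2 * Real.sqrt 2 * h * dWaveGap k : ℝ) : ℂ) else ((-(torusBand L k - μ') : ℝ) : ℂ))) *
        (if σ' = 0 then
          (if σ = 0 then ((1 / 2 - Real.tanh (β * Real.sqrt ((torusBand L k - μ') ^ 2 + (2 * Real.sqrt 2 * h * dWaveGap k) ^ 2) / 2) / (2 * Real.sqrt ((torusBand L k - μ') ^ 2 + (2 * Real.sqrt 2 * h * dWaveGap k) ^ 2)) * (torusBand L k - μ') : ℝ) : ℂ) else ((-(Real.tanh (β * Real.sqrt ((torusBand L k - μ') ^ 2 + (2 * Real.sqrt 2 * h * dWaveGap k) ^ 2) / 2) / (2 * Real.sqrt ((torusBand L k - μ') ^ 2 + (2 * Real.sqrt 2 * h * dWaveGap k) ^ 2)) * (2 * Real.sqrt 2 * h * dWaveGap k)) : ℝ) : ℂ))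
        else
          (if σ = 0 then ((-(Real.tanh (β * Real.sqrt ((torusBand L k - μ') ^ 2 + (2 * Real.sqrt 2 * h * dWaveGap k) ^ 2) / 2) / (2 * Real.sqrt ((torusBand L k - μ') ^ 2 + (2 * Real.sqrt 2 * h * dWaveGap k) ^ 2)) * (2 * Real.sqrt 2 * h * dWaveGap k)) : ℝ) : ℂ) else ((1 / 2 + Real.tanh (β * Real.sqrt ((torusBand L k - μ') ^ 2 + (2 * Real.sqrt 2 * h * dWaveGap k) ^ 2) / 2) / (2 * Real.sqrt ((torusBand L k - μ') ^ 2 + (2 * Real.sqrt 2 * h * dWaveGap k) ^ 2)) * (torusBand L k - μ') : ℝ) : ℂ)))) =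
      ((L : ℂ) ^ 2)⁻¹ * ((-∑ k : TorusSite 2 L, Real.sqrt ((torusBand L k - μ') ^ 2 + (2 * Real.sqrt 2 * h * dWaveGap k) ^ 2) * Real.tanh (β * Real.sqrt ((torusBand L k - μ') ^ 2 + (2 * Real.sqrt 2 * h * dWaveGap k) ^ 2) / 2) : ℝ) : ℂ) := by
    intro x
    rw [Finset.sum_comm, Finset.sum_congr rfl fun k _ => htr k, ← Finset.mul_sum]
    congr 1
    push_cast
    rw [Finset.sum_neg_distrib]
  rw [Finset.sum_congr rfl fun x _ => hx x, Finset.sum_const, Finset.card_univ, nsmul_eq_mul]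
  have hcard : (Fintype.card (FermionTorus 2 L) : ℂ) = (L : ℂ) ^ 2 := by
    simp [FermionTorus, Fintype.card_lex]
  rw [hcard, ← mul_assoc, mul_inv_cancel₀ hL0, one_mul]

/-- A diagonal Fermi-matrix entry is a plain momentum average (`χ_k(0) = 1`). [cite: VondelftRalph2001, §4.2] -/
theorem fermiMatrix_dWaveNambu_diag (hL : 3 ≤ L) (μ' h β : ℝ) (x : FermionTorus 2 L) (σ σ' : Fin 2) :
    (1 + NormedSpace.exp ((β : ℂ) • bdgNambuMatrix
          (fun x y => if (fermionTorusGraph 2 L).Adj x y then -(1 : ℂ) else 0)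
          (fun u v : FermionTorus 2 L => -(h : ℂ) * ∑ i : Fin 2,
            if v = FermionTorus.ofTorusSite (u.toTorusSite + Pi.single i 1) then
              ((Real.sqrt 2 * (if i = 0 then 1 else -1) : ℝ) : ℂ) else 0) μ'))⁻¹ (orb x σ) (orb x σ') =
      ((L : ℂ) ^ 2)⁻¹ * ∑ k : TorusSite 2 L,
        (if σ = 0 then
          (if σ' = 0 then ((1 / 2 - Real.tanh (β * Real.sqrt ((torusBand L k - μ') ^ 2 + (2 * Real.sqrt 2 * h * dWaveGap k) ^ 2) / 2) / (2 * Real.sqrt ((torusBand L k - μ') ^ 2 + (2 * Real.sqrt 2 * h * dWaveGap k) ^ 2)) * (torusBand L k - μ') : ℝ) : ℂ) else ((-(Real.tanh (β * Real.sqrt ((torusBand L k - μ') ^ 2 + (2 * Real.sqrt 2 * h * dWaveGap k) ^ 2) / 2) / (2 * Real.sqrt ((torusBand L k - μ') ^ 2 + (2 * Real.sqrt 2 * h * dWaveGap k) ^ 2)) * (2 * Real.sqrt 2 * h * dWaveGap k)) : ℝ) : ℂ))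
        else
          (if σ' = 0 then ((-(Real.tanh (β * Real.sqrt ((torusBand L k - μ') ^ 2 + (2 * Real.sqrt 2 * h * dWaveGap k) ^ 2) / 2) / (2 * Real.sqrt ((torusBand L k - μ') ^ 2 + (2 * Real.sqrt 2 * h * dWaveGap k) ^ 2)) * (2 * Real.sqrt 2 * h * dWaveGap k)) : ℝ) : ℂ) else ((1 / 2 + Real.tanh (β * Real.sqrt ((torusBand L k - μ') ^ 2 + (2 * Real.sqrt 2 * h * dWaveGap k) ^ 2) / 2) / (2 * Real.sqrt ((torusBand L k - μ') ^ 2 + (2 * Real.sqrt 2 * h * dWaveGap k) ^ 2)) * (torusBand L k - μ') : ℝ) : ℂ))) := by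
  rw [fermiMatrix_dWaveNambu_apply hL μ' h β x x σ σ']
  simp only [sub_self, torusChar_zero_right, one_mul]

/-- **Hartree–Fock–BCS sourced cap in MOMENTUM SPACE** (the certifiable form of
`groundEnergy_dWaveSourceTorus_le_HFBCS`, `L ≥ 3`): with `ξ_k = ε_L(k) - μ'`, `g_k = 2√2 h ĝ_d(k)`,
`E_k = √(ξ_k² + g_k²)`, `t_k = tanh(βE_k/2)`, for every `β` and trial `μ'`,
`E₀(A_L(U,μ,h)) ≤ (-Σ_k E_k t_k - μ'L²) + (μ' - μ)·Σ_k (1 - ξ_k t_k/E_k)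
                 + U·L²·[ (Σ_k (1 - ξ_k t_k/E_k) / (2L²))² + (Σ_k g_k t_k/(2E_k) / L²)² ]`
— the three one-body sums of the cap evaluated by the Bloch–Fourier / BdG block diagonalisation of the
Nambu Fermi matrix (`fermiMatrix_dWaveNambu_apply`); the last square is the on-site anomalous amplitude
(zero by the `k₁ ↔ k₂` antisymmetry of `ĝ_d`, kept). An explicit finite sum of elementary functions:
interval arithmetic certifies it. [cite: BachLiebSolovej1994, §2] [cite: VondelftRalph2001, §4.2] -/
theorem groundEnergy_dWaveSourceTorus_le_HFBCS_kSpace (hL : 3 ≤ L) (U μ μ' h β : ℝ) :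
    (dWaveSourceTorus L U μ h).groundEnergy ≤
      (-(∑ k : TorusSite 2 L, Real.sqrt ((torusBand L k - μ') ^ 2 + (2 * Real.sqrt 2 * h * dWaveGap k) ^ 2) * Real.tanh (β * Real.sqrt ((torusBand L k - μ') ^ 2 + (2 * Real.sqrt 2 * h * dWaveGap k) ^ 2) / 2)) - μ' * (L : ℝ) ^ 2) +
        (μ' - μ) * (∑ k : TorusSite 2 L, (1 - (torusBand L k - μ') * Real.tanh (β * Real.sqrt ((torusBand L k - μ') ^ 2 + (2 * Real.sqrt 2 * h * dWaveGap k) ^ 2) / 2) / Real.sqrt ((torusBand L k - μ') ^ 2 + (2 * Real.sqrt 2 * h * dWaveGap k) ^ 2))) +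
        U * ((L : ℝ) ^ 2 *
          (((∑ k : TorusSite 2 L, (1 - (torusBand L k - μ') * Real.tanh (β * Real.sqrt ((torusBand L k - μ') ^ 2 + (2 * Real.sqrt 2 * h * dWaveGap k) ^ 2) / 2) / Real.sqrt ((torusBand L k - μ') ^ 2 + (2 * Real.sqrt 2 * h * dWaveGap k) ^ 2))) / (2 * (L : ℝ) ^ 2)) ^ 2 +
           ((∑ k : TorusSite 2 L, (2 * Real.sqrt 2 * h * dWaveGap k) * Real.tanh (β * Real.sqrt ((torusBand L k - μ') ^ 2 + (2 * Real.sqrt 2 * h * dWaveGap k) ^ 2) / 2) / (2 * Real.sqrt ((torusBand L k - μ') ^ 2 + (2 * Real.sqrt 2 * h * dWaveGap k) ^ 2))) / (L : ℝ) ^ 2) ^ 2)) := by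
  have hL0 : ((L : ℂ) ^ 2) ≠ 0 := by
    have : (L : ℂ) ≠ 0 := by exact_mod_cast NeZero.ne L
    positivity
  have hL0r : ((L : ℝ) ^ 2) ≠ 0 := by
    have : (L : ℝ) ≠ 0 := by exact_mod_cast NeZero.ne L
    positivity
  have hcard : (Fintype.card (FermionTorus 2 L) : ℂ) = (L : ℂ) ^ 2 := by
    simp [FermionTorus, Fintype.card_lex]
  have hcardkR : (Fintype.card (TorusSite 2 L) : ℝ) = (L : ℝ) ^ 2 := by
    rw [Fintype.card_fun, ZMod.card, Fintype.card_fin]; push_cast; ring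
  have key := groundEnergy_dWaveSourceTorus_le_HFBCS L U μ μ' h β
  rw [sum_dWaveNambu_mul_fermiMatrix_eq hL μ' h β] at key
  simp only [fermiMatrix_dWaveNambu_diag hL μ' h β, if_true, one_ne_zero, if_false, Finset.sum_const,
    Finset.card_univ, nsmul_eq_mul, hcard] at key
  -- the three complex expressions are casts of real ones
  have hX : (((-∑ k : TorusSite 2 L, Real.sqrt ((torusBand L k - μ') ^ 2 + (2 * Real.sqrt 2 * h * dWaveGap k) ^ 2) * Real.tanh (β * Real.sqrt ((torusBand L k - μ') ^ 2 + (2 * Real.sqrt 2 * h * dWaveGap k) ^ 2) / 2) : ℝ) : ℂ) - (μ' : ℂ) * (L : ℂ) ^ 2) =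
      (((-∑ k : TorusSite 2 L, Real.sqrt ((torusBand L k - μ') ^ 2 + (2 * Real.sqrt 2 * h * dWaveGap k) ^ 2) * Real.tanh (β * Real.sqrt ((torusBand L k - μ') ^ 2 + (2 * Real.sqrt 2 * h * dWaveGap k) ^ 2) / 2)) - μ' * (L : ℝ) ^ 2 : ℝ) : ℂ) := by
    push_cast; ring
  have hY : ((L : ℂ) ^ 2 * (((L : ℂ) ^ 2)⁻¹ * ∑ k : TorusSite 2 L, ((1 / 2 - Real.tanh (β * Real.sqrt ((torusBand L k - μ') ^ 2 + (2 * Real.sqrt 2 * h * dWaveGap k) ^ 2) / 2) / (2 * Real.sqrt ((torusBand L k - μ') ^ 2 + (2 * Real.sqrt 2 * h * dWaveGap k) ^ 2)) * (torusBand L k - μ') : ℝ) : ℂ) +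
        (1 - ((L : ℂ) ^ 2)⁻¹ * ∑ k : TorusSite 2 L, ((1 / 2 + Real.tanh (β * Real.sqrt ((torusBand L k - μ') ^ 2 + (2 * Real.sqrt 2 * h * dWaveGap k) ^ 2) / 2) / (2 * Real.sqrt ((torusBand L k - μ') ^ 2 + (2 * Real.sqrt 2 * h * dWaveGap k) ^ 2)) * (torusBand L k - μ') : ℝ) : ℂ)))) =
      (((L : ℝ) ^ 2 * (((L : ℝ) ^ 2)⁻¹ * ∑ k : TorusSite 2 L, (1 / 2 - Real.tanh (β * Real.sqrt ((torusBand L k - μ') ^ 2 + (2 * Real.sqrt 2 * h * dWaveGap k) ^ 2) / 2) / (2 * Real.sqrt ((torusBand L k - μ') ^ 2 + (2 * Real.sqrt 2 * h * dWaveGap k) ^ 2)) * (torusBand L k - μ')) +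
        (1 - ((L : ℝ) ^ 2)⁻¹ * ∑ k : TorusSite 2 L, (1 / 2 + Real.tanh (β * Real.sqrt ((torusBand L k - μ') ^ 2 + (2 * Real.sqrt 2 * h * dWaveGap k) ^ 2) / 2) / (2 * Real.sqrt ((torusBand L k - μ') ^ 2 + (2 * Real.sqrt 2 * h * dWaveGap k) ^ 2)) * (torusBand L k - μ')))) : ℝ) : ℂ) := by
    push_cast; ring
  have hZ : ((L : ℂ) ^ 2 * ((((L : ℂ) ^ 2)⁻¹ * ∑ k : TorusSite 2 L, ((1 / 2 - Real.tanh (β * Real.sqrt ((torusBand L k - μ') ^ 2 + (2 * Real.sqrt 2 * h * dWaveGap k) ^ 2) / 2) / (2 * Real.sqrt ((torusBand L k - μ') ^ 2 + (2 * Real.sqrt 2 * h * dWaveGap k) ^ 2)) * (torusBand L k - μ') : ℝ) : ℂ)) *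
        (1 - ((L : ℂ) ^ 2)⁻¹ * ∑ k : TorusSite 2 L, ((1 / 2 + Real.tanh (β * Real.sqrt ((torusBand L k - μ') ^ 2 + (2 * Real.sqrt 2 * h * dWaveGap k) ^ 2) / 2) / (2 * Real.sqrt ((torusBand L k - μ') ^ 2 + (2 * Real.sqrt 2 * h * dWaveGap k) ^ 2)) * (torusBand L k - μ') : ℝ) : ℂ)) +
        (((L : ℂ) ^ 2)⁻¹ * ∑ k : TorusSite 2 L, ((-(Real.tanh (β * Real.sqrt ((torusBand L k - μ') ^ 2 + (2 * Real.sqrt 2 * h * dWaveGap k) ^ 2) / 2) / (2 * Real.sqrt ((torusBand L k - μ') ^ 2 + (2 * Real.sqrt 2 * h * dWaveGap k) ^ 2)) * (2 * Real.sqrt 2 * h * dWaveGap k)) : ℝ) : ℂ)) *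
        (((L : ℂ) ^ 2)⁻¹ * ∑ k : TorusSite 2 L, ((-(Real.tanh (β * Real.sqrt ((torusBand L k - μ') ^ 2 + (2 * Real.sqrt 2 * h * dWaveGap k) ^ 2) / 2) / (2 * Real.sqrt ((torusBand L k - μ') ^ 2 + (2 * Real.sqrt 2 * h * dWaveGap k) ^ 2)) * (2 * Real.sqrt 2 * h * dWaveGap k)) : ℝ) : ℂ)))) =
      (((L : ℝ) ^ 2 * ((((L : ℝ) ^ 2)⁻¹ * ∑ k : TorusSite 2 L, (1 / 2 - Real.tanh (β * Real.sqrt ((torusBand L k - μ') ^ 2 + (2 * Real.sqrt 2 * h * dWaveGap k) ^ 2) / 2) / (2 * Real.sqrt ((torusBand L k - μ') ^ 2 + (2 * Real.sqrt 2 * h * dWaveGap k) ^ 2)) * (torusBand L k - μ'))) *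
        (1 - ((L : ℝ) ^ 2)⁻¹ * ∑ k : TorusSite 2 L, (1 / 2 + Real.tanh (β * Real.sqrt ((torusBand L k - μ') ^ 2 + (2 * Real.sqrt 2 * h * dWaveGap k) ^ 2) / 2) / (2 * Real.sqrt ((torusBand L k - μ') ^ 2 + (2 * Real.sqrt 2 * h * dWaveGap k) ^ 2)) * (torusBand L k - μ'))) +
        (((L : ℝ) ^ 2)⁻¹ * ∑ k : TorusSite 2 L, (-(Real.tanh (β * Real.sqrt ((torusBand L k - μ') ^ 2 + (2 * Real.sqrt 2 * h * dWaveGap k) ^ 2) / 2) / (2 * Real.sqrt ((torusBand L k - μ') ^ 2 + (2 * Real.sqrt 2 * h * dWaveGap k) ^ 2)) * (2 * Real.sqrt 2 * h * dWaveGap k)))) *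
        (((L : ℝ) ^ 2)⁻¹ * ∑ k : TorusSite 2 L, (-(Real.tanh (β * Real.sqrt ((torusBand L k - μ') ^ 2 + (2 * Real.sqrt 2 * h * dWaveGap k) ^ 2) / 2) / (2 * Real.sqrt ((torusBand L k - μ') ^ 2 + (2 * Real.sqrt 2 * h * dWaveGap k) ^ 2)) * (2 * Real.sqrt 2 * h * dWaveGap k))))) : ℝ) : ℂ) := by
    push_cast; ring
  rw [hX, hY, hZ, Complex.ofReal_re, Complex.ofReal_re, Complex.ofReal_re] at key
  refine key.trans (le_of_eq ?_)
  -- real bookkeeping of the momentum sums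
  have hA : ∑ k : TorusSite 2 L, (1 / 2 - Real.tanh (β * Real.sqrt ((torusBand L k - μ') ^ 2 + (2 * Real.sqrt 2 * h * dWaveGap k) ^ 2) / 2) / (2 * Real.sqrt ((torusBand L k - μ') ^ 2 + (2 * Real.sqrt 2 * h * dWaveGap k) ^ 2)) * (torusBand L k - μ')) =
      (L : ℝ) ^ 2 / 2 - ∑ k : TorusSite 2 L, Real.tanh (β * Real.sqrt ((torusBand L k - μ') ^ 2 + (2 * Real.sqrt 2 * h * dWaveGap k) ^ 2) / 2) / (2 * Real.sqrt ((torusBand L k - μ') ^ 2 + (2 * Real.sqrt 2 * h * dWaveGap k) ^ 2)) * (torusBand L k - μ') := by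
    rw [Finset.sum_sub_distrib, Finset.sum_const, Finset.card_univ, nsmul_eq_mul, hcardkR]; ring
  have hB : ∑ k : TorusSite 2 L, (1 / 2 + Real.tanh (β * Real.sqrt ((torusBand L k - μ') ^ 2 + (2 * Real.sqrt 2 * h * dWaveGap k) ^ 2) / 2) / (2 * Real.sqrt ((torusBand L k - μ') ^ 2 + (2 * Real.sqrt 2 * h * dWaveGap k) ^ 2)) * (torusBand L k - μ')) =
      (L : ℝ) ^ 2 / 2 + ∑ k : TorusSite 2 L, Real.tanh (β * Real.sqrt ((torusBand L k - μ') ^ 2 + (2 * Real.sqrt 2 * h * dWaveGap k) ^ 2) / 2) / (2 * Real.sqrt ((torusBand L k - μ') ^ 2 + (2 * Real.sqrt 2 * h * dWaveGap k) ^ 2)) * (torusBand L k - μ') := by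
    rw [Finset.sum_add_distrib, Finset.sum_const, Finset.card_univ, nsmul_eq_mul, hcardkR]; ring
  have hC : ∑ k : TorusSite 2 L, (-(Real.tanh (β * Real.sqrt ((torusBand L k - μ') ^ 2 + (2 * Real.sqrt 2 * h * dWaveGap k) ^ 2) / 2) / (2 * Real.sqrt ((torusBand L k - μ') ^ 2 + (2 * Real.sqrt 2 * h * dWaveGap k) ^ 2)) * (2 * Real.sqrt 2 * h * dWaveGap k))) = -∑ k : TorusSite 2 L, Real.tanh (β * Real.sqrt ((torusBand L k - μ') ^ 2 + (2 * Real.sqrt 2 * h * dWaveGap k) ^ 2) / 2) / (2 * Real.sqrt ((torusBand L k - μ') ^ 2 + (2 * Real.sqrt 2 * h * dWaveGap k) ^ 2)) * (2 * Real.sqrt 2 * h * dWaveGap k) := by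
    rw [← Finset.sum_neg_distrib]
  have hN : ∑ k : TorusSite 2 L, (1 - (torusBand L k - μ') * Real.tanh (β * Real.sqrt ((torusBand L k - μ') ^ 2 + (2 * Real.sqrt 2 * h * dWaveGap k) ^ 2) / 2) / Real.sqrt ((torusBand L k - μ') ^ 2 + (2 * Real.sqrt 2 * h * dWaveGap k) ^ 2)) =
      (L : ℝ) ^ 2 - 2 * ∑ k : TorusSite 2 L, Real.tanh (β * Real.sqrt ((torusBand L k - μ') ^ 2 + (2 * Real.sqrt 2 * h * dWaveGap k) ^ 2) / 2) / (2 * Real.sqrt ((torusBand L k - μ') ^ 2 + (2 * Real.sqrt 2 * h * dWaveGap k) ^ 2)) * (torusBand L k - μ') := by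
    rw [Finset.sum_sub_distrib, Finset.sum_const, Finset.card_univ, nsmul_eq_mul, hcardkR, Finset.mul_sum, mul_one]
    congr 1
    exact Finset.sum_congr rfl fun k _ => by ring
  have hC' : ∑ k : TorusSite 2 L, (2 * Real.sqrt 2 * h * dWaveGap k) * Real.tanh (β * Real.sqrt ((torusBand L k - μ') ^ 2 + (2 * Real.sqrt 2 * h * dWaveGap k) ^ 2) / 2) / (2 * Real.sqrt ((torusBand L k - μ') ^ 2 + (2 * Real.sqrt 2 * h * dWaveGap k) ^ 2)) =
      ∑ k : TorusSite 2 L, Real.tanh (β * Real.sqrt ((torusBand L k - μ') ^ 2 + (2 * Real.sqrt 2 * h * dWaveGap k) ^ 2) / 2) / (2 * Real.sqrt ((torusBand L k - μ') ^ 2 + (2 * Real.sqrt 2 * h * dWaveGap k) ^ 2)) * (2 * Real.sqrt 2 * h * dWaveGap k) :=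
    Finset.sum_congr rfl fun k _ => by ring
  rw [hA, hB, hC, hN, hC']
  generalize (∑ k : TorusSite 2 L, Real.tanh (β * Real.sqrt ((torusBand L k - μ') ^ 2 + (2 * Real.sqrt 2 * h * dWaveGap k) ^ 2) / 2) / (2 * Real.sqrt ((torusBand L k - μ') ^ 2 + (2 * Real.sqrt 2 * h * dWaveGap k) ^ 2)) * (torusBand L k - μ')) = D
  generalize (∑ k : TorusSite 2 L, Real.tanh (β * Real.sqrt ((torusBand L k - μ') ^ 2 + (2 * Real.sqrt 2 * h * dWaveGap k) ^ 2) / 2) / (2 * Real.sqrt ((torusBand L k - μ') ^ 2 + (2 * Real.sqrt 2 * h * dWaveGap k) ^ 2)) * (2 * Real.sqrt 2 * h * dWaveGap k)) = Cg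
  generalize (∑ k : TorusSite 2 L, Real.sqrt ((torusBand L k - μ') ^ 2 + (2 * Real.sqrt 2 * h * dWaveGap k) ^ 2) * Real.tanh (β * Real.sqrt ((torusBand L k - μ') ^ 2 + (2 * Real.sqrt 2 * h * dWaveGap k) ^ 2) / 2)) = Et
  field_simp
  ring

/-- **The on-site anomalous amplitude of the `d`-wave pinned free torus vanishes**: the momentum sum
`Σ_k g_k tanh(βE_k/2)/(2E_k)` is zero, since the coordinate swap `k ↦ (k₂, k₁)` preserves `ε_L(k)` and `E_k` and
flips the sign of `ĝ_d(k) = cos k₁ − cos k₂`. [cite: Scalapino1995, §2] -/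
theorem sum_dWave_anomalous_eq_zero (μ' h β : ℝ) :
    ∑ k : TorusSite 2 L, (2 * Real.sqrt 2 * h * dWaveGap k) * Real.tanh (β * Real.sqrt ((torusBand L k - μ') ^ 2 + (2 * Real.sqrt 2 * h * dWaveGap k) ^ 2) / 2) / (2 * Real.sqrt ((torusBand L k - μ') ^ 2 + (2 * Real.sqrt 2 * h * dWaveGap k) ^ 2)) = 0 := by
  -- the coordinate swap as an involution of the momentum torus
  let e : TorusSite 2 L ≃ TorusSite 2 L :=
    { toFun := fun k i => k (Equiv.swap (0 : Fin 2) 1 i)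
      invFun := fun k i => k (Equiv.swap (0 : Fin 2) 1 i)
      left_inv := fun k => by funext i; simp [Equiv.swap_apply_self]
      right_inv := fun k => by funext i; simp [Equiv.swap_apply_self] }
  have hband : ∀ k : TorusSite 2 L, torusBand L (e k) = torusBand L k := by
    intro k
    unfold torusBand latticeMomentum
    simp only [Fin.sum_univ_two, e, Equiv.coe_fn_mk, Equiv.swap_apply_left, Equiv.swap_apply_right]
    ring
  have hgap : ∀ k : TorusSite 2 L, dWaveGap (e k) = -dWaveGap k := by
    intro k
    unfold dWaveGap latticeMomentum
    simp only [e, Equiv.coe_fn_mk, Equiv.swap_apply_left, Equiv.swap_apply_right]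
    ring
  have hterm : ∀ k : TorusSite 2 L,
      (fun k : TorusSite 2 L => (2 * Real.sqrt 2 * h * dWaveGap k) * Real.tanh (β * Real.sqrt ((torusBand L k - μ') ^ 2 + (2 * Real.sqrt 2 * h * dWaveGap k) ^ 2) / 2) / (2 * Real.sqrt ((torusBand L k - μ') ^ 2 + (2 * Real.sqrt 2 * h * dWaveGap k) ^ 2))) (e k) =
        -(fun k : TorusSite 2 L => (2 * Real.sqrt 2 * h * dWaveGap k) * Real.tanh (β * Real.sqrt ((torusBand L k - μ') ^ 2 + (2 * Real.sqrt 2 * h * dWaveGap k) ^ 2) / 2) / (2 * Real.sqrt ((torusBand L k - μ') ^ 2 + (2 * Real.sqrt 2 * h * dWaveGap k) ^ 2))) k := by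
    intro k
    simp only [hband k, hgap k]
    ring_nf
  have hsum := Equiv.sum_comp e (fun k : TorusSite 2 L => (2 * Real.sqrt 2 * h * dWaveGap k) * Real.tanh (β * Real.sqrt ((torusBand L k - μ') ^ 2 + (2 * Real.sqrt 2 * h * dWaveGap k) ^ 2) / 2) / (2 * Real.sqrt ((torusBand L k - μ') ^ 2 + (2 * Real.sqrt 2 * h * dWaveGap k) ^ 2)))
  rw [Finset.sum_congr rfl fun k _ => hterm k, Finset.sum_neg_distrib] at hsum
  simp only at hsum
  linarith

/-- **Hartree–Fock–BCS sourced cap in momentum space, anomalous term removed** (`L ≥ 3`):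
`E₀(A_L(U,μ,h)) ≤ (-Σ_k E_k t_k - μ'L²) + (μ' - μ)·Σ_k (1 - ξ_k t_k/E_k) + U·L²·(Σ_k (1 - ξ_k t_k/E_k)/(2L²))²`
— the free pinned BCS trial energy plus the Hartree term `U·L²·(n_L/2)²`, `n_L = L⁻²Σ_k(1 − ξ_k t_k/E_k)` the trial
density; every `β` and trial `μ'` is admissible. The certifiable cap of the W4 leg. [cite: BachLiebSolovej1994, §2]
[cite: VondelftRalph2001, §4.2] -/
theorem groundEnergy_dWaveSourceTorus_le_HFBCS_kSpace' (hL : 3 ≤ L) (U μ μ' h β : ℝ) :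
    (dWaveSourceTorus L U μ h).groundEnergy ≤
      (-(∑ k : TorusSite 2 L, Real.sqrt ((torusBand L k - μ') ^ 2 + (2 * Real.sqrt 2 * h * dWaveGap k) ^ 2) * Real.tanh (β * Real.sqrt ((torusBand L k - μ') ^ 2 + (2 * Real.sqrt 2 * h * dWaveGap k) ^ 2) / 2)) - μ' * (L : ℝ) ^ 2) +
        (μ' - μ) * (∑ k : TorusSite 2 L, (1 - (torusBand L k - μ') * Real.tanh (β * Real.sqrt ((torusBand L k - μ') ^ 2 + (2 * Real.sqrt 2 * h * dWaveGap k) ^ 2) / 2) / Real.sqrt ((torusBand L k - μ') ^ 2 + (2 * Real.sqrt 2 * h * dWaveGap k) ^ 2))) +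
        U * ((L : ℝ) ^ 2 *
          ((∑ k : TorusSite 2 L, (1 - (torusBand L k - μ') * Real.tanh (β * Real.sqrt ((torusBand L k - μ') ^ 2 + (2 * Real.sqrt 2 * h * dWaveGap k) ^ 2) / 2) / Real.sqrt ((torusBand L k - μ') ^ 2 + (2 * Real.sqrt 2 * h * dWaveGap k) ^ 2))) / (2 * (L : ℝ) ^ 2)) ^ 2) := by
  have key := groundEnergy_dWaveSourceTorus_le_HFBCS_kSpace hL U μ μ' h β
  rw [sum_dWave_anomalous_eq_zero μ' h β, zero_div, sq (0 : ℝ), mul_zero, add_zero] at key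
  exact key

end KSpaceCap

end Summit.Ventures.CertifiedManyBodySolver.Observables

end
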